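import Summits.AnomalousDissipation.AnomalousDissipation.Theorems.SolenoidalFractalHomogenisationLagrangianStepCellLawVOddGainDefectSectorialSlot
import HarnessLib

/-!
# K1L `LagrangianRenormalisationStep(Design)` (K1L_D, stmt-AnomalousDissipation-27980; aside 24912), stub `stub_cellLawV0_IS`
# — W5 odd half, O2⁺ (iv): CLOSED-FORM BOUNDS FOR THE SLOT SCALARS `f_T(a)`, `g_T(a)` — the odd quasi-static window from ARITHMETIC only
# (helper; `--supports stmt-AnomalousDissipation-27980`)

Summits-side helper file of route `SolenoidalFractalHomogenisation` (prover seat `ad-k1l-cellLawV-w1` g2), on top of `…CellLawVOddGainDefectSectorialSlot`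
(`oddSectorial_excQS_of_sectorial`, p655074), whose per-slot hypotheses are inequalities between the slot SCALARS `f_T(a) = qsRespScalar ρ T a`
(p643071) and `g_T(a) = qsRespMoment ρ T a` (p652418).  This file bounds them in closed form (`ϑ_∞ := 1 − 4ρ/3 = ∫₀¹a(s)²ds`, `0 < ρ ≤ 1/2`):
* `qsRespScalar_le`: `f_T(a) ≤ ϑ_∞/a` (`a·f_T(a) = ϑ(ρ,Ta)` and ad-lit's upper law `mul_integral_duhamel_le_integral_sq` + `integral_trapezoid_sq`, p636417);
* `le_qsRespScalar`: `f_T(a) ≥ (ϑ_∞ − 2/(ρ(Ta)²))/a` (ad-lit's `abs_slotWeight_sub_le`, Majda–Kramer §2.2.1.3);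
* `qsRespScalar_antitone`, `qsRespMoment_antitone` (monotone slot functional, p654671);
* **`qsRespMoment_le`: `g_T(a) ≤ ϑ_∞/a²` — SHARP** (attained as `T → ∞`), with NO Fubini: AM–GM `a(s)a(x) ≤ ½(a(s)² + a(x)²)` inside the
  non-negative kernel `T(s−x)e^{−T(s−x)a}`; the `a(s)²` half by the kernel mass `T∫₀ˢT(s−x)e^{−T(s−x)a}dx = (1 − (1+Tsa)e^{−Tsa})/a² ≤ 1/a²`
  (`kernel_moment_mass_le`, explicit antiderivative); the `a(x)²` half by the DUAL bound `kernel_moment_dual_le`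
  `T∫₀¹∫₀ˢψ(x)T(s−x)e^{−T(s−x)a} = ∫₀¹ψ/a² − Φ(1) ≤ ∫₀¹ψ/a²`, `Φ(s) = ∫₀ˢψ(x)(T(s−x)/a + 1/a²)e^{−T(s−x)a}dx` differentiated through the
  primitives `∫₀ˢe^{Tax}ψ`, `∫₀ˢxe^{Tax}ψ` (the device of ad-lit's `hasDerivAt_duhamel`);
* **`oddSectorial_excQS_of_design`** — `oddSectorial_excQS_of_sectorial` with the slot scalars eliminated: for `W₀` (`ρ₀ = W₀.ramp = 1/2`,
  `ϑ_∞ = 1/3`), `M ≥ 0`, `0 < lo ≤ 1 ≤ hi`, `τ, τ' ≥ 0`, box `[y, c·y]`, a lower bound `T₀ > 0` of the slot relaxations `4π²|m_s|²Mτ_s`, and with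
  `ε₀ = 2/(ρ₀(T₀hi)²)`, `m₀ = (ϑ_∞ − ε₀)/hi − (τhi/2)ϑ_∞/lo²`: the three NUMERICAL inequalities `y ≤ m₀`, `ϑ_∞/lo ≤ c·y`, `τ·hi·ϑ_∞/lo² ≤ τ'·m₀`
  give `NearIso S lo hi ∧ OddSectorial S τ ⇒ OddSectorial (excQS W₀ M S) ((c√5/3)·τ')`.  Read-off (`T₀ → ∞`, `τ → 0`): `c ≥ hi/lo = ΛV²`,
  `τ'/τ ≥ (hi/lo)² = ΛV⁴`, so `κ = (c√5/3)(τ'/τ) ≈ 0.745·ΛV⁶`.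
Everything PROVED, no definition, no named fact, no sorry.  Infrastructure for route-1's rung leaf F-D1.A0 (frontier FORMAL rung); NOT a proof of the
stub, of the crux, of Onsager's conjecture or of anomalous dissipation.  Prover seat `ad-k1l-cellLawV-w1` g2, 2026-08-28.
-/

set_option linter.dupNamespace false

noncomputable section

namespace Summit.AnomalousDissipation.AnomalousDissipation.Theorems.SolenoidalFractalHomogenisation.LagrangianStep.OddGain

open Matrix Finset MeasureTheory Set
open Literature.Analysis Literature.Analysis.FunctionSpaces Literature.Analysis.FluidPDE
open Literature.Analysis.FluidPDE.LatticeShear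

/-! ## §6 Closed-form bounds for the slot scalars -/

section SlotScalars

/-- **Upper bound for the slot response scalar**: `f_T(a) ≤ ϑ_∞/a`, `ϑ_∞ = 1 − 4ρ/3 = ∫₀¹a(s)²ds` (`0 < ρ ≤ 1/2`, `T ≥ 0`, `a > 0`):
`a·f_T(a) = ϑ(ρ, Ta)` (p643071 `mul_qsRespScalar_eq_slotWeight`) and ad-lit's upper law `ϑ ≤ ∫a²` (`mul_integral_duhamel_le_integral_sq`,
`integral_trapezoid_sq`, p636417). [folklore] -/
theorem qsRespScalar_le {ρ T a : ℝ} (hρ : 0 < ρ) (hρ2 : ρ ≤ 1 / 2) (hT : 0 ≤ T) (ha : 0 < a) :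
    qsRespScalar ρ T a ≤ (1 - 4 * ρ / 3) / a := by
  rcases hT.eq_or_lt with h0 | hTpos
  · have hz : qsRespScalar ρ T a = 0 := by unfold qsRespScalar; rw [← h0, zero_mul]
    rw [hz]
    exact div_nonneg (by linarith) ha.le
  · rw [le_div_iff₀ ha, mul_comm, mul_qsRespScalar_eq_slotWeight]
    unfold slotWeight
    have h := mul_integral_duhamel_le_integral_sq (continuous_trapezoid_unit ρ) (mul_pos hTpos ha) zero_le_one
    rw [integral_trapezoid_sq one_pos hρ hρ2, one_mul] at h
    exact h

/-- **Lower bound for the slot response scalar**: `f_T(a) ≥ (ϑ_∞ − 2/(ρ(Ta)²))/a` (`0 < ρ ≤ 1/2`, `T, a > 0`) — ad-lit's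
`abs_slotWeight_sub_le` (`|ϑ(ρ,t) − ϑ_∞| ≤ 2/(ρt²)`, Majda–Kramer §2.2.1.3, p636417). [folklore] -/
theorem le_qsRespScalar {ρ T a : ℝ} (hρ : 0 < ρ) (hρ2 : ρ ≤ 1 / 2) (hT : 0 < T) (ha : 0 < a) :
    (1 - 4 * ρ / 3 - 2 / (ρ * (T * a) ^ 2)) / a ≤ qsRespScalar ρ T a := by
  rw [div_le_iff₀ ha, mul_comm (qsRespScalar ρ T a), mul_qsRespScalar_eq_slotWeight]
  unfold slotWeight
  have h := abs_slotWeight_sub_le one_pos hρ hρ2 (mul_pos hT ha)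
  rw [div_one, one_pow, mul_one] at h
  have h2 := (abs_le.1 h).1
  linarith

/-- **Monotonicity**: `f_T` is non-increasing in its argument (`T ≥ 0`). [folklore] -/
theorem qsRespScalar_antitone {ρ T a a' : ℝ} (hT : 0 ≤ T) (haa' : a ≤ a') : qsRespScalar ρ T a' ≤ qsRespScalar ρ T a := by
  have h := qsKernel_mono (ρ := ρ) hT (g := fun t => Real.exp (-t * a')) (h := fun t => Real.exp (-t * a)) (by fun_prop) (by fun_prop)
    (fun t ht => Real.exp_le_exp.2 (by nlinarith))
  unfold qsRespScalar
  exact h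

/-- **Monotonicity**: `g_T` is non-increasing in its argument (`T ≥ 0`). [folklore] -/
theorem qsRespMoment_antitone {ρ T a a' : ℝ} (hT : 0 ≤ T) (haa' : a ≤ a') : qsRespMoment ρ T a' ≤ qsRespMoment ρ T a := by
  have h := qsKernel_mono (ρ := ρ) hT (g := fun t => t * Real.exp (-t * a')) (h := fun t => t * Real.exp (-t * a)) (by fun_prop)
    (by fun_prop) (fun t ht => mul_le_mul_of_nonneg_left (Real.exp_le_exp.2 (by nlinarith)) ht)
  unfold qsRespMoment
  exact h

/-- The mass of the first-moment kernel on a slot: `T∫₀ˢ T(s−x)e^{−T(s−x)a}dx = (1 − (1 + Tsa)e^{−Tsa})/a² ≤ 1/a²` (`s ≥ 0`, `a > 0`;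
antiderivative `(T(s−x)/a + 1/a²)e^{−T(s−x)a}`). [folklore] -/
theorem kernel_moment_mass_le {T a : ℝ} (ha : 0 < a) (hT : 0 ≤ T) {s : ℝ} (hs : 0 ≤ s) :
    T * ∫ x in (0:ℝ)..s, (T * (s - x)) * Real.exp (-(T * (s - x)) * a) ≤ 1 / a ^ 2 := by
  have hG : ∀ x ∈ uIcc (0:ℝ) s, HasDerivAt (fun x : ℝ => (T * (s - x) / a + 1 / a ^ 2) * Real.exp (-(T * (s - x)) * a))
      (T * ((T * (s - x)) * Real.exp (-(T * (s - x)) * a))) x := by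
    intro x _
    have h1 : HasDerivAt (fun x : ℝ => T * (s - x) / a + 1 / a ^ 2) (-(T / a)) x := by
      have hf : (fun x : ℝ => T * (s - x) / a + 1 / a ^ 2) = fun x => -(T / a) * x + (T * s / a + 1 / a ^ 2) := by
        ext y; ring
      rw [hf]
      simpa using ((hasDerivAt_id x).const_mul (-(T / a))).add_const (T * s / a + 1 / a ^ 2)
    have h2 : HasDerivAt (fun x : ℝ => Real.exp (-(T * (s - x)) * a)) (Real.exp (-(T * (s - x)) * a) * (T * a)) x := by
      have hf : (fun x : ℝ => Real.exp (-(T * (s - x)) * a)) = fun x => Real.exp (T * a * x - T * a * s) := by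
        ext y; congr 1; ring
      have hlin : HasDerivAt (fun x : ℝ => T * a * x - T * a * s) (T * a) x := by
        simpa using ((hasDerivAt_id x).const_mul (T * a)).sub_const (T * a * s)
      rw [hf]
      refine hlin.exp.congr_deriv ?_
      rw [show T * a * x - T * a * s = -(T * (s - x)) * a by ring]
    have h := h1.mul h2
    refine h.congr_deriv ?_
    field_simp
    ring
  rw [← intervalIntegral.integral_const_mul, intervalIntegral.integral_eq_sub_of_hasDerivAt hG
    ((by fun_prop : Continuous fun x : ℝ => T * ((T * (s - x)) * Real.exp (-(T * (s - x)) * a))).intervalIntegrable _ _)]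
  simp only [sub_self, mul_zero, zero_div, zero_add, neg_zero, zero_mul, Real.exp_zero, mul_one, sub_zero]
  have hpos : 0 ≤ (T * s / a + 1 / a ^ 2) * Real.exp (-(T * s) * a) := by positivity
  linarith

/-- The DUAL moment bound (the `a(x)²` half of AM–GM, WITHOUT Fubini): for a continuous `ψ`,
`T∫₀¹∫₀ˢ ψ(x)·T(s−x)e^{−T(s−x)a} dx ds = ∫₀¹ψ/a² − Φ(1) ≤ ∫₀¹ψ/a²` when `ψ ≥ 0` on `[0,1]`, where
`Φ(s) = ∫₀ˢψ(x)(T(s−x)/a + 1/a²)e^{−T(s−x)a}dx` solves `Φ' = ψ/a² − T·∫₀ˢψ(x)T(s−x)e^{−T(s−x)a}dx` (written through `∫₀ˢe^{Tax}ψ`, `∫₀ˢxe^{Tax}ψ`,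
as in ad-lit's `hasDerivAt_duhamel`). [folklore] -/
theorem kernel_moment_dual_le {T a : ℝ} (ha : 0 < a) (hT : 0 ≤ T) {ψ : ℝ → ℝ} (hψ : Continuous ψ) (hψ0 : ∀ x ∈ Icc (0:ℝ) 1, 0 ≤ ψ x) :
    T * ∫ s in (0:ℝ)..1, ∫ x in (0:ℝ)..s, ψ x * ((T * (s - x)) * Real.exp (-(T * (s - x)) * a)) ≤ (∫ s in (0:ℝ)..1, ψ s) / a ^ 2 := by
  -- the two primitive integrals
  set A : ℝ → ℝ := fun s => ∫ x in (0:ℝ)..s, Real.exp ((T * a) * x) * ψ x with hA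
  set B : ℝ → ℝ := fun s => ∫ x in (0:ℝ)..s, Real.exp ((T * a) * x) * (x * ψ x) with hB
  have hcA : Continuous fun x => Real.exp ((T * a) * x) * ψ x := by fun_prop
  have hcB : Continuous fun x => Real.exp ((T * a) * x) * (x * ψ x) := by fun_prop
  have hdA : ∀ s, HasDerivAt A (Real.exp ((T * a) * s) * ψ s) s := fun s => (hcA.integral_hasStrictDerivAt 0 s).hasDerivAt
  have hdB : ∀ s, HasDerivAt B (Real.exp ((T * a) * s) * (s * ψ s)) s := fun s => (hcB.integral_hasStrictDerivAt 0 s).hasDerivAt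
  have hA0 : A 0 = 0 := by simp [hA]
  have hB0 : B 0 = 0 := by simp [hB]
  have hexp : ∀ s : ℝ, Real.exp (-(T * a) * s) * Real.exp ((T * a) * s) = 1 := fun s => by
    rw [← Real.exp_add]; simp
  -- the bridge: the kernel integral through `A`, `B`
  have hbridge : ∀ s : ℝ, ∫ x in (0:ℝ)..s, ψ x * ((T * (s - x)) * Real.exp (-(T * (s - x)) * a)) =
      T * Real.exp (-(T * a) * s) * (s * A s - B s) := by
    intro s
    show _ = T * Real.exp (-(T * a) * s) * (s * (∫ x in (0:ℝ)..s, Real.exp ((T * a) * x) * ψ x) -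
      ∫ x in (0:ℝ)..s, Real.exp ((T * a) * x) * (x * ψ x))
    rw [← intervalIntegral.integral_const_mul, ← intervalIntegral.integral_sub ((hcA.intervalIntegrable _ _).const_mul s)
      (hcB.intervalIntegrable _ _), ← intervalIntegral.integral_const_mul]
    refine intervalIntegral.integral_congr fun x _ => ?_
    have he : Real.exp (-(T * (s - x)) * a) = Real.exp (-(T * a) * s) * Real.exp ((T * a) * x) := by
      rw [← Real.exp_add]; congr 1; ring
    simp only [he]
    ring
  -- the potential `Φ` and its derivative
  set Φ : ℝ → ℝ := fun s => Real.exp (-(T * a) * s) * ((T * s / a + 1 / a ^ 2) * A s - (T / a) * B s) with hΦ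
  have hdΦ : ∀ s, HasDerivAt Φ (ψ s / a ^ 2 - T * (T * Real.exp (-(T * a) * s) * (s * A s - B s))) s := by
    intro s
    have h1 : HasDerivAt (fun s : ℝ => Real.exp (-(T * a) * s)) (Real.exp (-(T * a) * s) * (-(T * a))) s := by
      have := ((hasDerivAt_id s).const_mul (-(T * a))).exp
      simpa using this
    have h2 : HasDerivAt (fun s : ℝ => T * s / a + 1 / a ^ 2) (T / a) s := by
      have := (((hasDerivAt_id s).const_mul T).div_const a).add_const (1 / a ^ 2)
      simpa using this
    have h3 : HasDerivAt (fun s : ℝ => (T * s / a + 1 / a ^ 2) * A s - (T / a) * B s)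
        ((T / a) * A s + (T * s / a + 1 / a ^ 2) * (Real.exp ((T * a) * s) * ψ s) -
          (T / a) * (Real.exp ((T * a) * s) * (s * ψ s))) s :=
      (h2.mul (hdA s)).sub ((hdB s).const_mul (T / a))
    have h := h1.mul h3
    refine h.congr_deriv ?_
    have hE : Real.exp (-(T * a) * s) = (Real.exp ((T * a) * s))⁻¹ := by
      rw [← Real.exp_neg]; congr 1; ring
    rw [hE]
    have hpos : Real.exp ((T * a) * s) ≠ 0 := (Real.exp_pos _).ne'
    field_simp
    ring
  -- integrate `Φ'` over `[0, 1]`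
  have hcΦ' : Continuous fun s => ψ s / a ^ 2 - T * (T * Real.exp (-(T * a) * s) * (s * A s - B s)) := by
    have hcA' : Continuous A := continuous_iff_continuousAt.2 fun s => (hdA s).continuousAt
    have hcB' : Continuous B := continuous_iff_continuousAt.2 fun s => (hdB s).continuousAt
    fun_prop
  have hftc := intervalIntegral.integral_eq_sub_of_hasDerivAt (fun s _ => hdΦ s) (hcΦ'.intervalIntegrable 0 1)
  rw [intervalIntegral.integral_sub ((hψ.div_const _).intervalIntegrable _ _)
      ((by have hcA' : Continuous A := continuous_iff_continuousAt.2 fun s => (hdA s).continuousAt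
           have hcB' : Continuous B := continuous_iff_continuousAt.2 fun s => (hdB s).continuousAt
           fun_prop : Continuous fun s => T * (T * Real.exp (-(T * a) * s) * (s * A s - B s))).intervalIntegrable _ _),
    intervalIntegral.integral_div, intervalIntegral.integral_const_mul] at hftc
  have hΦ0 : Φ 0 = 0 := by simp [hΦ, hA0, hB0]
  -- `Φ 1 ≥ 0`
  have hΦ1 : 0 ≤ Φ 1 := by
    have e1 : Φ 1 = ∫ x in (0:ℝ)..1, ψ x * ((T * (1 - x) / a + 1 / a ^ 2) * Real.exp (-(T * (1 - x)) * a)) := by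
      show Real.exp (-(T * a) * 1) * ((T * 1 / a + 1 / a ^ 2) * (∫ x in (0:ℝ)..1, Real.exp ((T * a) * x) * ψ x) -
          (T / a) * ∫ x in (0:ℝ)..1, Real.exp ((T * a) * x) * (x * ψ x)) = _
      rw [mul_sub, ← mul_assoc, ← mul_assoc, ← intervalIntegral.integral_const_mul, ← intervalIntegral.integral_const_mul,
        ← intervalIntegral.integral_sub ((hcA.intervalIntegrable _ _).const_mul _) ((hcB.intervalIntegrable _ _).const_mul _)]
      refine intervalIntegral.integral_congr fun x _ => ?_
      have he : Real.exp (-(T * (1 - x)) * a) = Real.exp (-(T * a) * 1) * Real.exp ((T * a) * x) := by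
        rw [← Real.exp_add]; congr 1; ring
      simp only [he]
      ring
    rw [e1]
    refine intervalIntegral.integral_nonneg zero_le_one fun x hx => ?_
    have h1x : 0 ≤ 1 - x := by linarith [hx.2]
    exact mul_nonneg (hψ0 x hx) (by positivity)
  -- conclude
  have key : T * ∫ s in (0:ℝ)..1, ∫ x in (0:ℝ)..s, ψ x * ((T * (s - x)) * Real.exp (-(T * (s - x)) * a)) =
      T * ∫ s in (0:ℝ)..1, T * Real.exp (-(T * a) * s) * (s * A s - B s) := by
    congr 1
    exact intervalIntegral.integral_congr fun s _ => hbridge s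
  rw [key]
  linarith

/-- Continuity of the inner moment integral `s ↦ ∫₀ˢ ψ(x)·T(s−x)e^{−T(s−x)a} dx` for continuous `ψ`. [folklore] -/
theorem continuous_inner_moment (T a : ℝ) {ψ : ℝ → ℝ} (hψ : Continuous ψ) :
    Continuous fun s : ℝ => ∫ x in (0:ℝ)..s, ψ x * ((T * (s - x)) * Real.exp (-(T * (s - x)) * a)) := by
  have hf : Continuous (Function.uncurry fun s x : ℝ => ψ x * ((T * (s - x)) * Real.exp (-(T * (s - x)) * a))) := by
    exact (hψ.comp continuous_snd).mul (by fun_prop : Continuous fun p : ℝ × ℝ => (T * (p.1 - p.2)) * Real.exp (-(T * (p.1 - p.2)) * a))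
  exact intervalIntegral.continuous_parametric_intervalIntegral_of_continuous (a₀ := 0) hf continuous_id

/-- **SHARP UPPER BOUND FOR THE FIRST KERNEL MOMENT**: `g_T(a) ≤ ϑ_∞/a²`, `ϑ_∞ = 1 − 4ρ/3` (`0 < ρ ≤ 1/2`, `T ≥ 0`, `a > 0`) — AM–GM
`a(s)a(x) ≤ ½(a(s)² + a(x)²)` inside the non-negative kernel, the `a(s)²` half by the kernel mass `≤ 1/a²` (`kernel_moment_mass_le`), the
`a(x)²` half by the dual bound (`kernel_moment_dual_le`), and `∫₀¹a² = 1 − 4ρ/3` (`integral_trapezoid_sq`).  The constant is attained as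
`T → ∞`. [folklore] -/
theorem qsRespMoment_le {ρ T a : ℝ} (hρ : 0 < ρ) (hρ2 : ρ ≤ 1 / 2) (hT : 0 ≤ T) (ha : 0 < a) :
    qsRespMoment ρ T a ≤ (1 - 4 * ρ / 3) / a ^ 2 := by
  set φ : ℝ → ℝ := fun s => LatticeShear.LatticeWord.trapezoid 0 1 ρ s with hφ
  have hφc : Continuous φ := continuous_trapezoid_unit ρ
  have hφ0 : ∀ s, 0 ≤ φ s := trapezoid_unit_nonneg ρ
  have hK0 : ∀ s x : ℝ, x ≤ s → 0 ≤ (T * (s - x)) * Real.exp (-(T * (s - x)) * a) := fun s x hxs =>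
    mul_nonneg (mul_nonneg hT (by linarith)) (Real.exp_pos _).le
  -- Step 1: AM–GM inside the kernel, pointwise in `s ∈ [0,1]`
  have hpt : ∀ s ∈ Icc (0:ℝ) 1, T * (φ s * ∫ x in (0:ℝ)..s, φ x * ((T * (s - x)) * Real.exp (-(T * (s - x)) * a))) ≤
      φ s ^ 2 / (2 * a ^ 2) + T / 2 * ∫ x in (0:ℝ)..s, φ x ^ 2 * ((T * (s - x)) * Real.exp (-(T * (s - x)) * a)) := by
    intro s hs
    have hs0 : 0 ≤ s := hs.1
    have h1 : φ s * ∫ x in (0:ℝ)..s, φ x * ((T * (s - x)) * Real.exp (-(T * (s - x)) * a)) ≤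
        ∫ x in (0:ℝ)..s, (φ s ^ 2 / 2 * ((T * (s - x)) * Real.exp (-(T * (s - x)) * a)) +
          (1 / 2) * (φ x ^ 2 * ((T * (s - x)) * Real.exp (-(T * (s - x)) * a)))) := by
      rw [← intervalIntegral.integral_const_mul]
      refine intervalIntegral.integral_mono_on hs0 ?_ ?_ fun x hx => ?_
      · exact (by fun_prop : Continuous fun x : ℝ =>
          φ s * (φ x * ((T * (s - x)) * Real.exp (-(T * (s - x)) * a)))).intervalIntegrable _ _
      · exact (by fun_prop : Continuous fun x : ℝ => φ s ^ 2 / 2 * ((T * (s - x)) * Real.exp (-(T * (s - x)) * a)) +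
          (1 / 2) * (φ x ^ 2 * ((T * (s - x)) * Real.exp (-(T * (s - x)) * a)))).intervalIntegrable _ _
      · have hk := hK0 s x hx.2
        nlinarith [sq_nonneg (φ s - φ x), hk]
    rw [intervalIntegral.integral_add
        ((by fun_prop : Continuous fun x : ℝ => φ s ^ 2 / 2 * ((T * (s - x)) * Real.exp (-(T * (s - x)) * a))).intervalIntegrable _ _)
        ((by fun_prop : Continuous fun x : ℝ =>
          (1 / 2) * (φ x ^ 2 * ((T * (s - x)) * Real.exp (-(T * (s - x)) * a)))).intervalIntegrable _ _),
      intervalIntegral.integral_const_mul, intervalIntegral.integral_const_mul] at h1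
    have h2 := kernel_moment_mass_le ha hT hs0
    have hφs : 0 ≤ φ s ^ 2 / 2 := by positivity
    have h3 : T * (φ s ^ 2 / 2 * ∫ x in (0:ℝ)..s, (T * (s - x)) * Real.exp (-(T * (s - x)) * a)) ≤ φ s ^ 2 / (2 * a ^ 2) := by
      calc T * (φ s ^ 2 / 2 * ∫ x in (0:ℝ)..s, (T * (s - x)) * Real.exp (-(T * (s - x)) * a))
          = φ s ^ 2 / 2 * (T * ∫ x in (0:ℝ)..s, (T * (s - x)) * Real.exp (-(T * (s - x)) * a)) := by ring
        _ ≤ φ s ^ 2 / 2 * (1 / a ^ 2) := mul_le_mul_of_nonneg_left h2 hφs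
        _ = φ s ^ 2 / (2 * a ^ 2) := by ring
    nlinarith [mul_le_mul_of_nonneg_left h1 hT, h3]
  -- Step 2: integrate over `[0, 1]`
  have hJφ : Continuous fun s : ℝ => ∫ x in (0:ℝ)..s, φ x * ((T * (s - x)) * Real.exp (-(T * (s - x)) * a)) :=
    continuous_inner_moment T a hφc
  have hJψ : Continuous fun s : ℝ => ∫ x in (0:ℝ)..s, φ x ^ 2 * ((T * (s - x)) * Real.exp (-(T * (s - x)) * a)) :=
    continuous_inner_moment T a (hφc.pow 2)
  have hIl : IntervalIntegrable (fun s => T * (φ s * ∫ x in (0:ℝ)..s, φ x * ((T * (s - x)) * Real.exp (-(T * (s - x)) * a))))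
      volume 0 1 := (continuous_const.mul (hφc.mul hJφ)).intervalIntegrable _ _
  have hI1 : IntervalIntegrable (fun s => φ s ^ 2 / (2 * a ^ 2)) volume 0 1 := ((hφc.pow 2).div_const _).intervalIntegrable _ _
  have hI2 : IntervalIntegrable (fun s => T / 2 * ∫ x in (0:ℝ)..s, φ x ^ 2 * ((T * (s - x)) * Real.exp (-(T * (s - x)) * a)))
      volume 0 1 := (continuous_const.mul hJψ).intervalIntegrable _ _
  have hmono := intervalIntegral.integral_mono_on zero_le_one hIl (hI1.add hI2) hpt
  rw [intervalIntegral.integral_const_mul, intervalIntegral.integral_add hI1 hI2,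
    intervalIntegral.integral_div, intervalIntegral.integral_const_mul] at hmono
  -- Step 3: the dual half
  have hdual := kernel_moment_dual_le ha hT (ψ := fun x => φ x ^ 2) (hφc.pow 2) (fun x _ => sq_nonneg (φ x))
  have hsq : ∫ s in (0:ℝ)..1, φ s ^ 2 = 1 - 4 * ρ / 3 := by
    have := integral_trapezoid_sq one_pos hρ hρ2
    rw [one_mul] at this
    exact this
  rw [hsq] at hmono hdual
  -- Step 4: assemble
  unfold qsRespMoment
  have ha2 : 0 < a ^ 2 := by positivity
  calc T * ∫ s in (0:ℝ)..1, φ s * ∫ x in (0:ℝ)..s, φ x * ((T * (s - x)) * Real.exp (-(T * (s - x)) * a))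
      ≤ (1 - 4 * ρ / 3) / (2 * a ^ 2) + T / 2 * ∫ s in (0:ℝ)..1, ∫ x in (0:ℝ)..s,
          φ x ^ 2 * ((T * (s - x)) * Real.exp (-(T * (s - x)) * a)) := hmono
    _ ≤ (1 - 4 * ρ / 3) / (2 * a ^ 2) + (1 / 2) * ((1 - 4 * ρ / 3) / a ^ 2) := by nlinarith [hdual]
    _ = (1 - 4 * ρ / 3) / a ^ 2 := by field_simp; ring

/-- **THE ODD HALF OF THE QUASI-STATIC W5 WINDOW FROM ARITHMETIC ONLY.**  For the cubature word `W₀` (ramp `ρ₀ = W₀.ramp`, `ϑ_∞ = 1 − 4ρ₀/3`),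
`M ≥ 0`, a window `0 < lo ≤ 1 ≤ hi`, block sector `τ ≥ 0`, response sector `τ' ≥ 0`, a box `[y, c·y]` (`y, c ≥ 0`) and a lower bound `T₀ > 0` of
the slot relaxations `T_s = 4π²|m_s|²Mτ_s`: if, with `ε₀ = 2/(ρ₀(T₀·hi)²)` and `m₀ = (ϑ_∞ − ε₀)/hi − (τhi/2)·ϑ_∞/lo²`, the three NUMERICAL
inequalities `y ≤ m₀`, `ϑ_∞/lo ≤ c·y`, `τ·hi·ϑ_∞/lo² ≤ τ'·m₀` hold, then `NearIso S lo hi ∧ OddSectorial S τ ⇒ OddSectorial (excQS W₀ M S) ((c√5/3)·τ')`.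
(`oddSectorial_excQS_of_sectorial` with the slot scalars bounded by `le_qsRespScalar`, `qsRespScalar_le`, `qsRespMoment_le`.) [folklore] -/
theorem oddSectorial_excQS_of_design (Mlag : ℝ) (hM : 0 ≤ Mlag) {lo hi τ τ' y c T₀ : ℝ} (hlo : 0 < lo) (hlo1 : lo ≤ 1) (hhi1 : 1 ≤ hi)
    (hy : 0 ≤ y) (hc : 0 ≤ c) (hτ : 0 ≤ τ) (hτ' : 0 ≤ τ') (hT₀ : 0 < T₀)
    (hTs : ∀ s : Fin 26, T₀ ≤ 4 * Real.pi ^ 2 * ‖Torus.latticeVec (cubatureWord.phase s).m‖ ^ 2 * Mlag * (cubatureWord.phase s).τ)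
    (h1 : y ≤ (1 - 4 * cubatureWord.ramp / 3 - 2 / (cubatureWord.ramp * (T₀ * hi) ^ 2)) / hi -
      τ * hi / 2 * ((1 - 4 * cubatureWord.ramp / 3) / lo ^ 2))
    (h2 : (1 - 4 * cubatureWord.ramp / 3) / lo ≤ c * y)
    (h3 : τ * hi * ((1 - 4 * cubatureWord.ramp / 3) / lo ^ 2) ≤
      τ' * ((1 - 4 * cubatureWord.ramp / 3 - 2 / (cubatureWord.ramp * (T₀ * hi) ^ 2)) / hi -
        τ * hi / 2 * ((1 - 4 * cubatureWord.ramp / 3) / lo ^ 2)))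
    {S : Torus.Visc4 (Fin 3)} (hS : Torus.NearIso S lo hi) (hodd : OddSectorial S τ) :
    OddSectorial (excQS cubatureWord Mlag S) (c * Real.sqrt 5 / 3 * τ') := by
  have hρ := cubatureWord.ramp_pos
  have hρ2 := cubatureWord.ramp_le
  have hhi : 0 < hi := by linarith
  have hτhi : 0 ≤ τ * hi := mul_nonneg hτ hhi.le
  refine oddSectorial_excQS_of_sectorial Mlag hM hlo hlo1 hhi1 hy hc hτ hτ' (fun s => ?_) hS hodd
  set T := 4 * Real.pi ^ 2 * ‖Torus.latticeVec (cubatureWord.phase s).m‖ ^ 2 * Mlag * (cubatureWord.phase s).τ with hTdef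
  have hT : T₀ ≤ T := hTs s
  have hTpos : 0 < T := hT₀.trans_le hT
  -- the three slot scalars against their closed-form bounds
  have hfhi : (1 - 4 * cubatureWord.ramp / 3 - 2 / (cubatureWord.ramp * (T₀ * hi) ^ 2)) / hi ≤ qsRespScalar cubatureWord.ramp T hi := by
    refine le_trans ?_ (le_qsRespScalar hρ hρ2 hTpos hhi)
    refine div_le_div_of_nonneg_right ?_ hhi.le
    have hmono : 2 / (cubatureWord.ramp * (T * hi) ^ 2) ≤ 2 / (cubatureWord.ramp * (T₀ * hi) ^ 2) := by
      refine div_le_div_of_nonneg_left (by norm_num) (by positivity) ?_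
      refine mul_le_mul_of_nonneg_left ?_ hρ.le
      exact pow_le_pow_left₀ (by positivity) (mul_le_mul_of_nonneg_right hT hhi.le) 2
    linarith
  have hflo : qsRespScalar cubatureWord.ramp T lo ≤ (1 - 4 * cubatureWord.ramp / 3) / lo := qsRespScalar_le hρ hρ2 hTpos.le hlo
  have hglo : qsRespMoment cubatureWord.ramp T lo ≤ (1 - 4 * cubatureWord.ramp / 3) / lo ^ 2 := qsRespMoment_le hρ hρ2 hTpos.le hlo
  have hm : (1 - 4 * cubatureWord.ramp / 3 - 2 / (cubatureWord.ramp * (T₀ * hi) ^ 2)) / hi -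
      τ * hi / 2 * ((1 - 4 * cubatureWord.ramp / 3) / lo ^ 2) ≤
      qsRespScalar cubatureWord.ramp T hi - τ * hi / 2 * qsRespMoment cubatureWord.ramp T lo := by
    have := mul_le_mul_of_nonneg_left hglo (by positivity : 0 ≤ τ * hi / 2)
    linarith
  refine ⟨h1.trans hm, hflo.trans h2, ?_⟩
  calc τ * hi * qsRespMoment cubatureWord.ramp T lo ≤ τ * hi * ((1 - 4 * cubatureWord.ramp / 3) / lo ^ 2) :=
        mul_le_mul_of_nonneg_left hglo hτhi
    _ ≤ τ' * ((1 - 4 * cubatureWord.ramp / 3 - 2 / (cubatureWord.ramp * (T₀ * hi) ^ 2)) / hi -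
        τ * hi / 2 * ((1 - 4 * cubatureWord.ramp / 3) / lo ^ 2)) := h3
    _ ≤ τ' * (qsRespScalar cubatureWord.ramp T hi - τ * hi / 2 * qsRespMoment cubatureWord.ramp T lo) :=
        mul_le_mul_of_nonneg_left hm hτ'

end SlotScalars

end Summit.AnomalousDissipation.AnomalousDissipation.Theorems.SolenoidalFractalHomogenisation.LagrangianStep.OddGain

end
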